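import Summits.QuantumFields.YangMills.Theorems.ColdStartUniversalityLatticeLangevinBlockLoopStringMixing
import Summits.QuantumFields.YangMills.Theorems.ColdStartUniversalityLatticeLangevinBakryEmeryConcentration
import HarnessLib

/-!
# Route `ColdStartUniversality` (fixed-cut-off package): Gaussian concentration of LOOP STRINGS (torus-averaged and BLOCK-averaged products of Wilson
# loops) under `μ_(β')` at `|β'| < 1/12` — two-sided Herbst bounds at the CLT scale `Σ_k(R_k+T_k)/√#sites` resp. `/√#B`, uniformly in the volume

Helper file (seat `ym-line-csu-p1`, g28; `--supports stmt-QuantumFields-24809`).  Equilibrium companion of `…LoopStringMixing` / `…BlockLoopStringMixing`: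
* ★★ `wilson_two_sided_concentration_uniform` — generic: `Γ(f) ≤ s` ⇒ `μ_(β'){r ≤ |F − μF|} ≤ 2exp(−(1−12|β'|)r²/s)` (g26's one-sided bound for `±f`);
* ★★★ `wilson_loopString_concentration_uniform` — `μ_(β'){r ≤ |∏_k W̄_k − ⟨·⟩|} ≤ 2exp(−(1−12|β'|)L³r²/(96(Σ_k(R_k+T_k))²))`;
* ★★★ `wilson_blockLoopString_concentration_uniform` — `μ_(β'){r ≤ |∏_k W̄_(B,k) − ⟨·⟩|} ≤ 2exp(−(1−12|β'|)#B·r²/(32(Σ_k(R_k+T_k))²))`.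
HONEST FRAMING: FIXED cut-off and fixed `|β'| < 1/12`; equilibrium statements; 24809 ASIDE not restated; nothing K-uniform; no crux, rung or summit
statement is proved; the Yang–Mills mass gap is NOT proved.  THEOREMS ONLY, no definition, no sorry.
-/

set_option autoImplicit false

noncomputable section

namespace Summit.QuantumFields.YangMills.Theorems.ColdStartUniversality

open MeasureTheory ProbabilityTheory Finset Filter Set
open scoped BigOperators NNReal ENNReal Topology Matrix
open Literature.Probability.Process Literature.MathematicalPhysics.QuantumFieldTheory
open Literature.MathematicalPhysics.QuantumLattice (fundamentalRep fundamentalLatticeRep continuous_fundamentalRep)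

variable {L : ℕ} [NeZero L]

/-- ★★ **Two-sided volume-uniform Gaussian concentration** under `μ_(β')`, `|β'| < 1/12`: for `f ∈ C³` with `Γ(f) ≤ s` (`s > 0`) and `r ≥ 0`,
`μ_(β'){V | r ≤ |F(V) − ∫F dμ_(β')|} ≤ 2·exp(−(1 − 12|β'|)·r²/s)` (`F = f∘coords`; g26's one-sided `wilson_concentration_uniform` applied to `f` and to
`−f`, which has the same carré du champ). [cite: ShenZhuZhu2022, §4 Theorem 4.2] -/
theorem wilson_two_sided_concentration_uniform (L : ℕ) [NeZero L] (β' : ℝ)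
    (f : (Edge 3 L × Fin 2 × Fin 2 × Bool → ℝ) → ℝ) (hf : ContDiff ℝ 3 f) (hβ : |β'| < 1 / 12) {s : ℝ} (hs : 0 < s) :
    let coords : GaugeConfig 3 L (Matrix.specialUnitaryGroup (Fin 2) ℂ) → (Edge 3 L × Fin 2 × Fin 2 × Bool → ℝ) :=
      fun V q => (fun z : ℂ => if q.2.2.2 then z.im else z.re)
        ((fundamentalRep (Fin 2) (V q.1) : Matrix (Fin 2) (Fin 2) ℂ) q.2.1 q.2.2.1)
    let A : GaugeConfig 3 L (Matrix.specialUnitaryGroup (Fin 2) ℂ) → (Edge 3 L × Fin 2 × Fin 2 × Bool) →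
        (Edge 3 L × Fin 2 × Fin 2 × Bool) → ℝ := fun V i j =>
      ∑ n : Edge 3 L × NoiseIdx 2,
        (if n.1 = i.1 then (fun z : ℂ => if i.2.2.2 then z.im else z.re)
          ((latticeLangevinDynamics (fundamentalLatticeRep 2) β').noise
            (matrixConfig (fundamentalRep (Fin 2)) V) i.1 n.2 i.2.1 i.2.2.1) else 0) *
        (if n.1 = j.1 then (fun z : ℂ => if j.2.2.2 then z.im else z.re)
          ((latticeLangevinDynamics (fundamentalLatticeRep 2) β').noise
            (matrixConfig (fundamentalRep (Fin 2)) V) j.1 n.2 j.2.1 j.2.2.1) else 0)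
    (∀ V, (∑ i : Edge 3 L × Fin 2 × Fin 2 × Bool, ∑ j : Edge 3 L × Fin 2 × Fin 2 × Bool, fderiv ℝ f (coords V) (Pi.single i 1) * fderiv ℝ f (coords V) (Pi.single j 1) * A V i j) ≤ s) → ∀ r : ℝ, 0 ≤ r →
      ((wilsonMeasure (d := 3) (L := L) (fundamentalRep (Fin 2)) β')).real {V | r ≤ |f (coords V) - ∫ V', f (coords V') ∂(wilsonMeasure (d := 3) (L := L) (fundamentalRep (Fin 2)) β')|} ≤ 2 * Real.exp (-((1 - 12 * |β'|) * r ^ 2 / s)) := by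
  intro coords A hΓ r hr
  classical
  haveI := secondCountableTopology_su2
  haveI := borelSpace_config L
  haveI : IsProbabilityMeasure (wilsonMeasure (d := 3) (L := L) (fundamentalRep (Fin 2)) β') :=
    isProbabilityMeasure_wilsonMeasure (d := 3) (L := L) (fundamentalRep (Fin 2)) (continuous_fundamentalRep (Fin 2)) β'
  -- the carré du champ of `−f`
  have hg : ContDiff ℝ 3 (fun z => -f z) := hf.neg
  have hΓg : ∀ V, (∑ i : Edge 3 L × Fin 2 × Fin 2 × Bool, ∑ j : Edge 3 L × Fin 2 × Fin 2 × Bool, fderiv ℝ (fun z => -f z) (coords V) (Pi.single i 1) * fderiv ℝ (fun z => -f z) (coords V) (Pi.single j 1) * A V i j) ≤ s := by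
    intro V
    have e : (∑ i : Edge 3 L × Fin 2 × Fin 2 × Bool, ∑ j : Edge 3 L × Fin 2 × Fin 2 × Bool, fderiv ℝ (fun z => -f z) (coords V) (Pi.single i 1) * fderiv ℝ (fun z => -f z) (coords V) (Pi.single j 1) * A V i j) = (∑ i : Edge 3 L × Fin 2 × Fin 2 × Bool, ∑ j : Edge 3 L × Fin 2 × Fin 2 × Bool, fderiv ℝ f (coords V) (Pi.single i 1) * fderiv ℝ f (coords V) (Pi.single j 1) * A V i j) := by
      refine Finset.sum_congr rfl fun i _ => Finset.sum_congr rfl fun j _ => ?_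
      rw [fderiv_fun_neg]
      simp only [neg_apply]
      ring
    rw [e]
    exact hΓ V
  have hp := wilson_concentration_uniform L β' hβ f hf hs hΓ r hr
  have hm := wilson_concentration_uniform L β' hβ (fun z => -f z) hg hs hΓg r hr
  have hmean : ∫ V', (fun z => -f z) (coords V') ∂(wilsonMeasure (d := 3) (L := L) (fundamentalRep (Fin 2)) β') = -∫ V', f (coords V') ∂(wilsonMeasure (d := 3) (L := L) (fundamentalRep (Fin 2)) β') := by
    beta_reduce; rw [integral_neg]
  have hsub : {V : (GaugeConfig 3 L (Matrix.specialUnitaryGroup (Fin 2) ℂ)) | r ≤ |f (coords V) - ∫ V', f (coords V') ∂(wilsonMeasure (d := 3) (L := L) (fundamentalRep (Fin 2)) β')|} ⊆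
      {V | (∫ V', f (coords V') ∂(wilsonMeasure (d := 3) (L := L) (fundamentalRep (Fin 2)) β')) + r ≤ f (coords V)} ∪ {V | (∫ V', (fun z => -f z) (coords V') ∂(wilsonMeasure (d := 3) (L := L) (fundamentalRep (Fin 2)) β')) + r ≤ (fun z => -f z) (coords V)} := by
    intro V hV
    simp only [Set.mem_setOf_eq, Set.mem_union] at hV ⊢
    rw [hmean]
    rcases le_abs.1 hV with h | h
    · left; linarith
    · right; linarith
  calc ((wilsonMeasure (d := 3) (L := L) (fundamentalRep (Fin 2)) β')).real {V : (GaugeConfig 3 L (Matrix.specialUnitaryGroup (Fin 2) ℂ)) | r ≤ |f (coords V) - ∫ V', f (coords V') ∂(wilsonMeasure (d := 3) (L := L) (fundamentalRep (Fin 2)) β')|}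
      ≤ ((wilsonMeasure (d := 3) (L := L) (fundamentalRep (Fin 2)) β')).real ({V | (∫ V', f (coords V') ∂(wilsonMeasure (d := 3) (L := L) (fundamentalRep (Fin 2)) β')) + r ≤ f (coords V)} ∪ {V | (∫ V', (fun z => -f z) (coords V') ∂(wilsonMeasure (d := 3) (L := L) (fundamentalRep (Fin 2)) β')) + r ≤ (fun z => -f z) (coords V)}) := measureReal_mono hsub
    _ ≤ ((wilsonMeasure (d := 3) (L := L) (fundamentalRep (Fin 2)) β')).real {V | (∫ V', f (coords V') ∂(wilsonMeasure (d := 3) (L := L) (fundamentalRep (Fin 2)) β')) + r ≤ f (coords V)} + ((wilsonMeasure (d := 3) (L := L) (fundamentalRep (Fin 2)) β')).real {V | (∫ V', (fun z => -f z) (coords V') ∂(wilsonMeasure (d := 3) (L := L) (fundamentalRep (Fin 2)) β')) + r ≤ (fun z => -f z) (coords V)} :=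
        measureReal_union_le _ _
    _ ≤ Real.exp (-((1 - 12 * |β'|) * r ^ 2 / s)) + Real.exp (-((1 - 12 * |β'|) * r ^ 2 / s)) := add_le_add hp hm
    _ = 2 * Real.exp (-((1 - 12 * |β'|) * r ^ 2 / s)) := by ring

/-- ★★★ **Volume-uniform Gaussian concentration of a LOOP STRING** (product of torus-averaged `R_k × T_k` Wilson loops) at `|β'| < 1/12`,
`Σ_k(R_k+T_k) > 0`, `r ≥ 0`: `μ_(β'){r ≤ |∏_k W̄_k − ⟨∏_k W̄_k⟩|} ≤ 2exp(−(1−12|β'|)·L³·r²/(96(Σ_k(R_k+T_k))²))` (`L³ = #sites`).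
[cite: ShenZhuZhu2022, §4 Theorem 4.2, Corollary 4.4] -/
theorem wilson_loopString_concentration_uniform (L : ℕ) [NeZero L] (β' : ℝ) (hβ : |β'| < 1 / 12) (m : ℕ) (i j : Fin m → Fin 3) (R T : Fin m → ℕ)
    (hRT : 0 < ∑ k, (R k + T k)) (r : ℝ) (hr : 0 ≤ r) :
    ((wilsonMeasure (d := 3) (L := L) (fundamentalRep (Fin 2)) β')).real {V | r ≤ |(∏ k : Fin m, (((Fintype.card (Site 3 L) : ℝ))⁻¹ * ∑ x : Site 3 L, wilsonLoop (fundamentalRep (Fin 2)) x (i k) (j k) (R k) (T k) V)) - ∫ V', (∏ k : Fin m, (((Fintype.card (Site 3 L) : ℝ))⁻¹ * ∑ x : Site 3 L, wilsonLoop (fundamentalRep (Fin 2)) x (i k) (j k) (R k) (T k) V')) ∂(wilsonMeasure (d := 3) (L := L) (fundamentalRep (Fin 2)) β')|} ≤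
      2 * Real.exp (-((1 - 12 * |β'|) * (Fintype.card (Site 3 L) : ℝ) * r ^ 2 / (96 * (∑ k : Fin m, ((R k : ℝ) + T k)) ^ 2))) := by
  classical
  haveI := secondCountableTopology_su2
  haveI := borelSpace_config L
  set μ : Measure (GaugeConfig 3 L (Matrix.specialUnitaryGroup (Fin 2) ℂ)) := (wilsonMeasure (d := 3) (L := L) (fundamentalRep (Fin 2)) β') with hμ
  haveI : IsProbabilityMeasure μ :=
    isProbabilityMeasure_wilsonMeasure (d := 3) (L := L) (fundamentalRep (Fin 2)) (continuous_fundamentalRep (Fin 2)) β'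
  have hS : (0 : ℝ) < (Fintype.card (Site 3 L) : ℝ) := card_site_three_pos L
  have hS0 : (Fintype.card (Site 3 L) : ℝ) ≠ 0 := hS.ne'
  have hRT' : (0 : ℝ) < (∑ k : Fin m, ((R k : ℝ) + T k)) := by
    have h : ((∑ k, (R k + T k) : ℕ) : ℝ) = (∑ k : Fin m, ((R k : ℝ) + T k)) := by push_cast; rfl
    rw [← h]; exact_mod_cast hRT
  set co : (GaugeConfig 3 L (Matrix.specialUnitaryGroup (Fin 2) ℂ)) → (Edge 3 L × Fin 2 × Fin 2 × Bool → ℝ) := (fun (V : GaugeConfig 3 L (Matrix.specialUnitaryGroup (Fin 2) ℂ)) (q : Edge 3 L × Fin 2 × Fin 2 × Bool) => (fun z : ℂ => if q.2.2.2 then z.im else z.re) ((fundamentalRep (Fin 2) (V q.1) : Matrix (Fin 2) (Fin 2) ℂ) q.2.1 q.2.2.1)) with hco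
  set F : Fin m → (Edge 3 L × Fin 2 × Fin 2 × Bool → ℝ) → ℝ := fun k => (fun y : (Edge 3 L × Fin 2 × Fin 2 × Bool → ℝ) => (2 * (Fintype.card (Site 3 L) : ℝ))⁻¹ * ∑ x : Site 3 L, ((((((List.range (R k)).map (fun m : ℕ => ((Pi.single (i k) ((m : ℕ) : ZMod L) : Site 3 L), (i k), false)) ++ (List.range (T k)).map (fun m : ℕ => ((Pi.single (i k) (((R k) : ℕ) : ZMod L) : Site 3 L) + (Pi.single (j k) ((m : ℕ) : ZMod L) : Site 3 L), (j k), false)) ++ ((List.range (R k)).map (fun m : ℕ => ((Pi.single (j k) (((T k) : ℕ) : ZMod L) : Site 3 L) + (Pi.single (i k) ((m : ℕ) : ZMod L) : Site 3 L), (i k), true))).reverse ++ ((List.range (T k)).map (fun m : ℕ => ((Pi.single (j k) ((m : ℕ) : ZMod L) : Site 3 L), (j k), true))).reverse).map (fun q : Site 3 L × Fin 3 × Bool => ((x + q.1, q.2.1), q.2.2))).map (fun a : Edge 3 L × Bool => if a.2 then ((fun (ee : Edge 3 L) => Matrix.of fun (i' j' : Fin 2) => ((y (ee, i', j', false) : ℝ)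 : ℂ) + ((y (ee, i', j', true) : ℝ) : ℂ) * Complex.I) a.1)ᴴ else (fun (ee : Edge 3 L) => Matrix.of fun (i' j' : Fin 2) => ((y (ee, i', j', false) : ℝ) : ℂ) + ((y (ee, i', j', true) : ℝ) : ℂ) * Complex.I) a.1)).prod)).trace.re) with hFdef
  have hfC : ContDiff ℝ 3 (fun y => ∏ k : Fin m, F k y) := contDiff_prod (fun k _ => contDiff_loopAverage _ _)
  have hval : ∀ (k) (V : (GaugeConfig 3 L (Matrix.specialUnitaryGroup (Fin 2) ℂ))), F k (co V) = (((Fintype.card (Site 3 L) : ℝ))⁻¹ * ∑ x : Site 3 L, wilsonLoop (fundamentalRep (Fin 2)) x (i k) (j k) (R k) (T k) V) :=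
    fun k V => loopAverage_coords_eq V (i k) (j k) (R k) (T k)
  have hvalP : ∀ V : (GaugeConfig 3 L (Matrix.specialUnitaryGroup (Fin 2) ℂ)), (fun y => ∏ k : Fin m, F k y) (co V) = (∏ k : Fin m, (((Fintype.card (Site 3 L) : ℝ))⁻¹ * ∑ x : Site 3 L, wilsonLoop (fundamentalRep (Fin 2)) x (i k) (j k) (R k) (T k) V)) :=
    fun V => Finset.prod_congr rfl fun k _ => hval k V
  have hs : 0 < 96 * (∑ k : Fin m, ((R k : ℝ) + T k)) ^ 2 / (Fintype.card (Site 3 L) : ℝ) := div_pos (mul_pos (by norm_num) (pow_pos hRT' 2)) hS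
  have hconc := wilson_two_sided_concentration_uniform L β' (fun y => ∏ k : Fin m, F k y) hfC hβ hs (wilson_loopString_carre_le L β' m i j R T) r hr
  have hset : {V : (GaugeConfig 3 L (Matrix.specialUnitaryGroup (Fin 2) ℂ)) | r ≤ |(∏ k : Fin m, (((Fintype.card (Site 3 L) : ℝ))⁻¹ * ∑ x : Site 3 L, wilsonLoop (fundamentalRep (Fin 2)) x (i k) (j k) (R k) (T k) V)) - ∫ V', (∏ k : Fin m, (((Fintype.card (Site 3 L) : ℝ))⁻¹ * ∑ x : Site 3 L, wilsonLoop (fundamentalRep (Fin 2)) x (i k) (j k) (R k) (T k) V')) ∂μ|} =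
      {V | r ≤ |(fun y => ∏ k : Fin m, F k y) (co V) - ∫ V', (fun y => ∏ k : Fin m, F k y) (co V') ∂μ|} := by
    ext V
    simp only [Set.mem_setOf_eq, hval]
  rw [hset]
  refine hconc.trans (le_of_eq ?_)
  congr 2
  field_simp

/-- ★★★ **Local Gaussian concentration of a BLOCK-averaged loop string** at `|β'| < 1/12` (`B` nonempty, `Σ_k(R_k+T_k) > 0`, `r ≥ 0`):
`μ_(β'){r ≤ |∏_k W̄_(B,k) − ⟨∏_k W̄_(B,k)⟩|} ≤ 2exp(−(1−12|β'|)·#B·r²/(32(Σ_k(R_k+T_k))²))` — the block's CLT scale, uniformly in `L`.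
[cite: ShenZhuZhu2022, §4 Theorem 4.2, Corollary 4.4] -/
theorem wilson_blockLoopString_concentration_uniform (L : ℕ) [NeZero L] (β' : ℝ) (hβ : |β'| < 1 / 12) (m : ℕ) (i j : Fin m → Fin 3) (R T : Fin m → ℕ)
    (hRT : 0 < ∑ k, (R k + T k)) (B : Finset (Site 3 L)) (hB : B.Nonempty) (r : ℝ) (hr : 0 ≤ r) :
    ((wilsonMeasure (d := 3) (L := L) (fundamentalRep (Fin 2)) β')).real {V | r ≤ |(∏ k : Fin m, (((B.card : ℝ))⁻¹ * ∑ x ∈ B, wilsonLoop (fundamentalRep (Fin 2)) x (i k) (j k) (R k) (T k) V)) - ∫ V', (∏ k : Fin m, (((B.card : ℝ))⁻¹ * ∑ x ∈ B, wilsonLoop (fundamentalRep (Fin 2)) x (i k) (j k) (R k) (T k) V')) ∂(wilsonMeasure (d := 3) (L := L) (fundamentalRep (Fin 2)) β')|} ≤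
      2 * Real.exp (-((1 - 12 * |β'|) * (B.card : ℝ) * r ^ 2 / (32 * (∑ k : Fin m, ((R k : ℝ) + T k)) ^ 2))) := by
  classical
  haveI := secondCountableTopology_su2
  haveI := borelSpace_config L
  set μ : Measure (GaugeConfig 3 L (Matrix.specialUnitaryGroup (Fin 2) ℂ)) := (wilsonMeasure (d := 3) (L := L) (fundamentalRep (Fin 2)) β') with hμ
  haveI : IsProbabilityMeasure μ :=
    isProbabilityMeasure_wilsonMeasure (d := 3) (L := L) (fundamentalRep (Fin 2)) (continuous_fundamentalRep (Fin 2)) β'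
  have hS : (0 : ℝ) < (B.card : ℝ) := by exact_mod_cast hB.card_pos
  have hS0 : (B.card : ℝ) ≠ 0 := hS.ne'
  have hRT' : (0 : ℝ) < (∑ k : Fin m, ((R k : ℝ) + T k)) := by
    have h : ((∑ k, (R k + T k) : ℕ) : ℝ) = (∑ k : Fin m, ((R k : ℝ) + T k)) := by push_cast; rfl
    rw [← h]; exact_mod_cast hRT
  set co : (GaugeConfig 3 L (Matrix.specialUnitaryGroup (Fin 2) ℂ)) → (Edge 3 L × Fin 2 × Fin 2 × Bool → ℝ) := (fun (V : GaugeConfig 3 L (Matrix.specialUnitaryGroup (Fin 2) ℂ)) (q : Edge 3 L × Fin 2 × Fin 2 × Bool) => (fun z : ℂ => if q.2.2.2 then z.im else z.re) ((fundamentalRep (Fin 2) (V q.1) : Matrix (Fin 2) (Fin 2) ℂ) q.2.1 q.2.2.1)) with hco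
  set F : Fin m → (Edge 3 L × Fin 2 × Fin 2 × Bool → ℝ) → ℝ := fun k => (fun y : (Edge 3 L × Fin 2 × Fin 2 × Bool → ℝ) => (2 * (B.card : ℝ))⁻¹ * ∑ x ∈ B, ((((((List.range (R k)).map (fun m : ℕ => ((Pi.single (i k) ((m : ℕ) : ZMod L) : Site 3 L), (i k), false)) ++ (List.range (T k)).map (fun m : ℕ => ((Pi.single (i k) (((R k) : ℕ) : ZMod L) : Site 3 L) + (Pi.single (j k) ((m : ℕ) : ZMod L) : Site 3 L), (j k), false)) ++ ((List.range (R k)).map (fun m : ℕ => ((Pi.single (j k) (((T k) : ℕ) : ZMod L) : Site 3 L) + (Pi.single (i k) ((m : ℕ) : ZMod L) : Site 3 L), (i k), true))).reverse ++ ((List.range (T k)).map (fun m : ℕ => ((Pi.single (j k) ((m : ℕ) : ZMod L) : Site 3 L), (j k), true))).reverse).map (fun q : Site 3 L × Fin 3 × Bool => ((x + q.1, q.2.1), q.2.2))).map (fun a : Edge 3 L × Bool => if a.2 then ((fun (ee : Edge 3 L) => Matrix.of fun (i' j' : Fin 2) => ((y (ee, i', j', false) : ℝ) : ℂ) + ((y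 (ee, i', j', true) : ℝ) : ℂ) * Complex.I) a.1)ᴴ else (fun (ee : Edge 3 L) => Matrix.of fun (i' j' : Fin 2) => ((y (ee, i', j', false) : ℝ) : ℂ) + ((y (ee, i', j', true) : ℝ) : ℂ) * Complex.I) a.1)).prod)).trace.re) with hFdef
  have hfC : ContDiff ℝ 3 (fun y => ∏ k : Fin m, F k y) := contDiff_prod (fun k _ => contDiff_blockLoopAverage _ _ B)
  have hval : ∀ (k) (V : (GaugeConfig 3 L (Matrix.specialUnitaryGroup (Fin 2) ℂ))), F k (co V) = (((B.card : ℝ))⁻¹ * ∑ x ∈ B, wilsonLoop (fundamentalRep (Fin 2)) x (i k) (j k) (R k) (T k) V) :=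
    fun k V => blockLoopAverage_coords_eq V (i k) (j k) (R k) (T k) B hB
  have hvalP : ∀ V : (GaugeConfig 3 L (Matrix.specialUnitaryGroup (Fin 2) ℂ)), (fun y => ∏ k : Fin m, F k y) (co V) = (∏ k : Fin m, (((B.card : ℝ))⁻¹ * ∑ x ∈ B, wilsonLoop (fundamentalRep (Fin 2)) x (i k) (j k) (R k) (T k) V)) :=
    fun V => Finset.prod_congr rfl fun k _ => hval k V
  have hs : 0 < 32 * (∑ k : Fin m, ((R k : ℝ) + T k)) ^ 2 / (B.card : ℝ) := div_pos (mul_pos (by norm_num) (pow_pos hRT' 2)) hS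
  have hconc := wilson_two_sided_concentration_uniform L β' (fun y => ∏ k : Fin m, F k y) hfC hβ hs (wilson_blockLoopString_carre_le L β' m i j R T B hB) r hr
  have hset : {V : (GaugeConfig 3 L (Matrix.specialUnitaryGroup (Fin 2) ℂ)) | r ≤ |(∏ k : Fin m, (((B.card : ℝ))⁻¹ * ∑ x ∈ B, wilsonLoop (fundamentalRep (Fin 2)) x (i k) (j k) (R k) (T k) V)) - ∫ V', (∏ k : Fin m, (((B.card : ℝ))⁻¹ * ∑ x ∈ B, wilsonLoop (fundamentalRep (Fin 2)) x (i k) (j k) (R k) (T k) V')) ∂μ|} =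
      {V | r ≤ |(fun y => ∏ k : Fin m, F k y) (co V) - ∫ V', (fun y => ∏ k : Fin m, F k y) (co V') ∂μ|} := by
    ext V
    simp only [Set.mem_setOf_eq, hval]
  rw [hset]
  refine hconc.trans (le_of_eq ?_)
  congr 2
  field_simp

end Summit.QuantumFields.YangMills.Theorems.ColdStartUniversality
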